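import Summits.CriticalPhenomena.PercolationContinuityZ3.Theorems.PercNearOneGluingNoHeavyLowerTailAntitheticPendantArmsShift
import Summits.CriticalPhenomena.PercolationContinuityZ3.Theorems.PercNearOneGluingNoHeavyLowerTailAntitheticHandlePrinciple
import Summits.CriticalPhenomena.PercolationContinuityZ3.Theorems.PercNearOneGluingNoHeavyLowerTailAntitheticDegTwoOneSided
import HarnessLib

/-!
# `NoHeavyLowerTail` (stmt-CriticalPhenomena-4575) — antithetic cluster pairs: the HANDLE PRINCIPLE WITH SHIFTED-BIC HYPOTHESES
# (the `𝒮_shift` re-base of …AntitheticHandlePrinciple; prim-hp-2 gen 65, HOME/MEMO-gen65.md §2(d), §5 (P3))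

Support file (`--supports stmt-CriticalPhenomena-4575`, hull-port prover `prim-hp-2`, gen 65).  No definitions, no named facts, no sorries;
standard axioms.  Setting and notation of …AntitheticHandlePrinciple (graph `K` with edge set `E₀`, handle through the fresh vertex `x`
with arms `u 0 = P, …, u a = y` and `w 0 = Q, …, w b = z`).  The hypotheses (⊕_j) and (M) are now required only for the SHIFTED-BIC
class `𝒮_shift = {K(X,Y) = F⁺(X) − F⁻(Y) : F⁻ ≤ F⁺ monotone}` instead of all super-odd twisted-monotone pairs:
  (⊕_j)_shift `Σ_{T : P ∈ X_{E₀ ∪ stub_j}} (F⁺(X) − F⁻(Y))(G⁺(X) − G⁻(Y)) ≥ 0` for all monotone `F⁻ ≤ F⁺`, `G⁻ ≤ G⁺`, every `j < b`;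
  (M)_shift  `Σ_{T : P ∈ X_{E₀}, Q ∉ Y_{E₀}} (F⁺(X) − F⁻(Y))(G⁺(X) − G⁻(Y)) ≥ 0` likewise.
The conclusion is unchanged: the vertex antithetic inequality at `R = {x}` (CONJECTURE Δ2) for `K` + handle, all monotone `F, G`.
The proof is the gen-62 proof verbatim: the degree-2 reduction feeds TERM II the pair `F(· ∪ {x}) − F(·)`, which is in `𝒮_shift`, and the
pendant reductions PR1/PR2 stay inside `𝒮_shift` (…AntitheticPendantArmsShift).  STRICTLY STRONGER than the 𝒮-version in reach:
`K_{2,4}` from a pole satisfies (⊕)_shift (kit j285856, exact over all 7 828 354 nested up-set pairs) but not (⊕) over 𝒮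
(…AntitheticK24NotOplus).
* `Antithetic.Pendant.handle_termTwo_nonneg_of_shift` — TERM II for shifted-BIC pairs under (⊕_j)_shift, (M)_shift.
* `Antithetic.Pendant.handle_vertex_sum_nonneg_of_shift` — the handle principle under (⊕_j)_shift, (M)_shift.
[cite: VandenbergHaggstromKahn2005, §1 p. 6 ("Harris' inequality"), §1 p. 3 (open cluster `C_s`)]
-/

noncomputable section

namespace Summit.CriticalPhenomena.PercolationContinuityZ3.Theorems

open Literature.Probability.Percolation
open scoped Classical

namespace Antithetic

namespace Pendant

variable {V : Type*} [Fintype V] {E₀ : Set (Sym2 V)} {s P Q : V} {u w : ℕ → V} {a b : ℕ}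
  (hu0 : u 0 = P) (hw0 : w 0 = Q)
  (hufresh : ∀ i, 0 < i → i ≤ a → ∀ f ∈ E₀ ∪ Cyc.edgeSet b w, u i ∈ f → f.IsDiag)
  (hwfresh : ∀ i, 0 < i → i ≤ b → ∀ f ∈ E₀, w i ∈ f → f.IsDiag)
  (huinj : ∀ i j, i ≤ a → j ≤ a → u i = u j → i = j) (hwinj : ∀ i j, i ≤ b → j ≤ b → w i = w j → i = j)
  (hsu : ∀ i, 0 < i → i ≤ a → s ≠ u i) (hsw : ∀ i, 0 < i → i ≤ b → s ≠ w i)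
  (hPw : ∀ i, 0 < i → i ≤ b → P ≠ w i) (hzu : ∀ i, 0 < i → i ≤ a → w b ≠ u i)
  (hoplus : ∀ j, j < b → ∀ Fp Fm Gp Gm : Set V → ℝ, Monotone Fp → Monotone Fm → (∀ S, Fm S ≤ Fp S) →
    Monotone Gp → Monotone Gm → (∀ S, Gm S ≤ Gp S) →
    0 ≤ ∑ T ∈ Finset.univ.filter (fun T : Set (Sym2 V) => P ∈ openCluster (T ∩ (E₀ ∪ Cyc.edgeSet j w)) s),
      (Fp (openCluster (T ∩ (E₀ ∪ Cyc.edgeSet j w)) s) - Fm (openCluster (Tᶜ ∩ (E₀ ∪ Cyc.edgeSet j w)) s)) *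
        (Gp (openCluster (T ∩ (E₀ ∪ Cyc.edgeSet j w)) s) - Gm (openCluster (Tᶜ ∩ (E₀ ∪ Cyc.edgeSet j w)) s)))
  (hmixed : ∀ Fp Fm Gp Gm : Set V → ℝ, Monotone Fp → Monotone Fm → (∀ S, Fm S ≤ Fp S) →
    Monotone Gp → Monotone Gm → (∀ S, Gm S ≤ Gp S) →
    0 ≤ ∑ T ∈ Finset.univ.filter (fun T : Set (Sym2 V) => P ∈ openCluster (T ∩ E₀) s ∧ Q ∉ openCluster (Tᶜ ∩ E₀) s),
      (Fp (openCluster (T ∩ E₀) s) - Fm (openCluster (Tᶜ ∩ E₀) s)) * (Gp (openCluster (T ∩ E₀) s) - Gm (openCluster (Tᶜ ∩ E₀) s)))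
include hu0 hw0 hufresh hwfresh huinj hwinj hsu hsw hPw hzu hoplus hmixed

/-- **Handle principle, TERM II, shifted-BIC class.**  Under (⊕_j)_shift and (M)_shift, for `H = (E₀ ∪ z-arm) ∪ y-arm` and all
monotone `F⁻ ≤ F⁺`, `G⁻ ≤ G⁺`: `0 ≤ Σ_{T : y ∈ X_H T, z ∉ Y_H T} (F⁺(X_H T) − F⁻(Y_H T))·(G⁺(X_H T) − G⁻(Y_H T))`. [this work] -/
theorem handle_termTwo_nonneg_of_shift (Fp Fm Gp Gm : Set V → ℝ) (hFp : Monotone Fp) (hFm : Monotone Fm) (hF : ∀ S, Fm S ≤ Fp S)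
    (hGp : Monotone Gp) (hGm : Monotone Gm) (hG : ∀ S, Gm S ≤ Gp S) :
    0 ≤ ∑ T ∈ Finset.univ.filter (fun T : Set (Sym2 V) =>
        u a ∈ openCluster (T ∩ ((E₀ ∪ Cyc.edgeSet b w) ∪ Cyc.edgeSet a u)) s ∧
          w b ∉ openCluster (Tᶜ ∩ ((E₀ ∪ Cyc.edgeSet b w) ∪ Cyc.edgeSet a u)) s),
      (Fp (openCluster (T ∩ ((E₀ ∪ Cyc.edgeSet b w) ∪ Cyc.edgeSet a u)) s) -
          Fm (openCluster (Tᶜ ∩ ((E₀ ∪ Cyc.edgeSet b w) ∪ Cyc.edgeSet a u)) s)) *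
        (Gp (openCluster (T ∩ ((E₀ ∪ Cyc.edgeSet b w) ∪ Cyc.edgeSet a u)) s) -
          Gm (openCluster (Tᶜ ∩ ((E₀ ∪ Cyc.edgeSet b w) ∪ Cyc.edgeSet a u)) s)) := by
  -- peel the `y`-arm (PR1)
  refine termTwo_path_nonneg_shift hufresh huinj hsu hzu ?_ le_rfl Fp Fm Gp Gm hFp hFm hF hGp hGm hG
  intro Lp Lm Mp Mm hLp hLm hL hMp hMm hM
  rw [hu0]
  -- peel the `z`-arm (PR2), paying (⊕)_shift for each remaining stub, and finish with (M)_shift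
  refine termTwo_stub_nonneg_shift hwfresh hwinj hsw hPw ?_ ?_ le_rfl Lp Lm Mp Mm hLp hLm hL hMp hMm hM
  · intro j hj Np Nm Op Om hNp hNm hN hOp hOm hO
    exact hoplus j hj Np Nm Op Om hNp hNm hN hOp hOm hO
  · intro Np Nm Op Om hNp hNm hN hOp hOm hO
    rw [hw0]
    exact hmixed Np Nm Op Om hNp hNm hN hOp hOm hO

/-- **HANDLE PRINCIPLE with shifted-BIC hypotheses.**  `K` any loop-free finite graph (edge set `E₀`) through `s`; `P, Q` vertices of
`K`; arms `u 0 = P, …, u a = y` and `w 0 = Q, …, w b = z` of fresh vertices; `x` fresh, joined to `y` and `z`; `yz` not a pair of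
`H = K ∪ arms`; `E = H + xy + xz`.  If (⊕_j)_shift and (M)_shift hold (module docstring), then for all monotone `F, G`:
`0 ≤ Σ_{ω : ¬(x ∈ X_E ω ∧ x ∈ Y_E ω)} (F(X_E ω) − F(Y_E ω))·(G(X_E ω) − G(Y_E ω))` (`H` written `(arm ∪ E₀) ∪ stub`). [this work] -/
theorem handle_vertex_sum_nonneg_of_shift (hnd : ∀ f ∈ E₀, ¬ f.IsDiag) {x : V}
    (hx : ∀ f ∈ (Cyc.edgeSet a u ∪ E₀) ∪ Cyc.edgeSet b w, x ∈ f → f.IsDiag)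
    (hxs : x ≠ s) (hxy : x ≠ u a) (hxz : x ≠ w b) (hyz : u a ≠ w b) (hg : s(u a, w b) ∉ (Cyc.edgeSet a u ∪ E₀) ∪ Cyc.edgeSet b w)
    {F G : Set V → ℝ} (hF : Monotone F) (hG : Monotone G) :
    0 ≤ ∑ ω ∈ Finset.univ.filter (fun ω : Set (Sym2 V) =>
        ¬ ((openGraph (ω ∩ insert s(x, u a) (insert s(x, w b) ((Cyc.edgeSet a u ∪ E₀) ∪ Cyc.edgeSet b w)))).Reachable s x ∧
          (openGraph (ωᶜ ∩ insert s(x, u a) (insert s(x, w b) ((Cyc.edgeSet a u ∪ E₀) ∪ Cyc.edgeSet b w)))).Reachable s x)),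
      (F (openCluster (ω ∩ insert s(x, u a) (insert s(x, w b) ((Cyc.edgeSet a u ∪ E₀) ∪ Cyc.edgeSet b w))) s) -
          F (openCluster (ωᶜ ∩ insert s(x, u a) (insert s(x, w b) ((Cyc.edgeSet a u ∪ E₀) ∪ Cyc.edgeSet b w))) s)) *
        (G (openCluster (ω ∩ insert s(x, u a) (insert s(x, w b) ((Cyc.edgeSet a u ∪ E₀) ∪ Cyc.edgeSet b w))) s) -
          G (openCluster (ωᶜ ∩ insert s(x, u a) (insert s(x, w b) ((Cyc.edgeSet a u ∪ E₀) ∪ Cyc.edgeSet b w))) s)) := by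
  -- (the edge set of `H` is written `(arm ∪ E₀) ∪ stub` here — …HandlePrinciple writes `(E₀ ∪ stub) ∪ arm`, …HandleOplus
  -- `(stub ∪ E₀) ∪ arm`, …HandleDual `arm ∪ (E₀ ∪ stub)`; same set, a fresh bracketing so that conclusions are not syntactic duplicates)
  have hcomm : (Cyc.edgeSet a u ∪ E₀) ∪ Cyc.edgeSet b w = (E₀ ∪ Cyc.edgeSet b w) ∪ Cyc.edgeSet a u := by
    rw [Set.union_comm (Cyc.edgeSet a u) E₀, Set.union_assoc, Set.union_comm (Cyc.edgeSet a u), ← Set.union_assoc]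
  rw [hcomm] at hx hg ⊢
  set EH := (E₀ ∪ Cyc.edgeSet b w) ∪ Cyc.edgeSet a u with hEH
  -- `H` has no loops
  have hnd' : ∀ f ∈ EH, ¬ f.IsDiag := by
    rintro f ((hf | ⟨i, hi, rfl⟩) | ⟨i, hi, rfl⟩)
    · exact hnd f hf
    · rw [Cyc.edge, Sym2.mk_isDiag_iff]; exact fun h => absurd (hwinj i (i + 1) (by omega) (by omega) h) (by omega)
    · rw [Cyc.edge, Sym2.mk_isDiag_iff]; exact fun h => absurd (huinj i (i + 1) (by omega) (by omega) h) (by omega)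
  have he' : s(x, u a) ∉ EH := fun h => absurd (hx _ h (Sym2.mem_mk_left _ _)) (hnd' _ h)
  have hf' : s(x, w b) ∉ EH := fun h => absurd (hx _ h (Sym2.mem_mk_left _ _)) (hnd' _ h)
  have hE' : insert s(x, u a) (insert s(x, w b) EH) \ {s(x, u a), s(x, w b)} = EH := by
    ext f
    simp only [Set.mem_sdiff, Set.mem_insert_iff, Set.mem_singleton_iff, not_or]
    constructor
    · rintro ⟨h1 | h1 | h1, h2, h3⟩
      · exact absurd h1 h2
      · exact absurd h1 h3
      · exact h1
    · intro h
      exact ⟨Or.inr (Or.inr h), fun h1 => he' (h1 ▸ h), fun h1 => hf' (h1 ▸ h)⟩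
  refine DegTwo.deg2_vertex_of_termTwo (E := insert s(x, u a) (insert s(x, w b) EH)) hxs hxy hxz hyz
    (Set.mem_insert _ _) (Set.mem_insert_of_mem _ (Set.mem_insert _ _)) ?_ ?_ hF hG ?_
  · -- `x` meets only the two new pairs
    intro h hh hxh
    rcases hh with h1 | h1 | h1
    · exact Or.inl h1
    · exact Or.inr h1
    · exact absurd (hx h h1 hxh) (hnd' h h1)
  · -- `yz` is not a pair
    intro h
    rcases h with h1 | h1 | h1
    · rcases Sym2.eq_iff.1 h1 with ⟨h2, -⟩ | ⟨-, h2⟩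
      · exact hxy h2.symm
      · exact hxz h2.symm
    · rcases Sym2.eq_iff.1 h1 with ⟨h2, -⟩ | ⟨h2, -⟩
      · exact hxy h2.symm
      · exact hyz h2
    · exact hg h1
  · -- TERM II by the handle principle
    rw [hE']
    have hK : ∀ {F : Set V → ℝ}, Monotone F → Monotone (fun A : Set V => F (A ∪ {x})) :=
      fun hF A A' hA => hF (Set.union_subset_union_left _ hA)
    exact handle_termTwo_nonneg_of_shift hu0 hw0 hufresh hwfresh huinj hwinj hsu hsw hPw hzu hoplus hmixed
      (fun A => F (A ∪ {x})) F (fun A => G (A ∪ {x})) G (hK hF) hF (fun S => hF Set.subset_union_left) (hK hG) hG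
      (fun S => hG Set.subset_union_left)

end Pendant

end Antithetic

end Summit.CriticalPhenomena.PercolationContinuityZ3.Theorems
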